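import Mathlib
import HarnessLib
import Summits.AnomalousDissipation.AnomalousDissipation.Theses.ImpulseGrid
import Literature.Analysis.FluidPDE.LinearizedNSTorus
import Literature.Analysis.FluidPDE.TorusClassicalLerayHopfProofs
import Literature.Analysis.FluidPDE.LongTimeAveragePeriodic
import Literature.Analysis.FluidPDE.LongTimeAverageSubadditive
import Literature.Analysis.FluidPDE.TimeAverageMeasureBasic
import Literature.Analysis.FluidPDE.TwoHalfNavierStokes
import Summits.AnomalousDissipation.AnomalousDissipation.Theorems.ImpulseGridBoundedEnergyGridStubColumnarOfPlanar
import Summits.AnomalousDissipation.AnomalousDissipation.Theorems.ImpulseGridBoundedEnergyGridStubAxisZeroOfAxisTwo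
import Summits.AnomalousDissipation.AnomalousDissipation.Theorems.ImpulseGridBoundedEnergyGridStubGridOfColumnar
import Summits.AnomalousDissipation.AnomalousDissipation.Theorems.ImpulseGridBoundedEnergyGridStubColumnarForwardOfPlanar
import Summits.AnomalousDissipation.AnomalousDissipation.Theorems.ImpulseGridBoundedEnergyGridStubForwardAxisZeroOfAxisTwo
import Summits.AnomalousDissipation.AnomalousDissipation.Theorems.ImpulseGridBoundedEnergyGridStubGridOfColumnarForward

/-!
# Line `Sketch` — crux `ImpulseGrid.BoundedEnergyGrid` (stmt-AnomalousDissipation-10430), skeleton v3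

Lead skeleton, continuation lead c1 (prover-line-stmt-AnomalousDissipation-10430-c1-0, 2026-08-16),
RESHAPED from v2 (lead 0): the single open stub is now held in its WEAKEST planar form.

THE LINE (unchanged mechanism). The unit-mass clause `∫ Φ = 1` admits the constant profile `Φ ≡ 1`;
then the force `Φ•G = G(x⊥)` is columnar (x₀-invariant, transverse) and the drift `c e₀` is inert on
x₀-invariant fields (`c ∂₀ V = 0`). Hence `u_j(t) := c e₀ + V_j(t)` with `V_j(t)` x₀-invariant,
transverse classical solutions of `NS_{ν_j}(G)` FORWARD IN TIME (`t ∈ [0, ∞)`) are classical solutions of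
`NS_{ν_j}(Φ•G)` with momentum `c e₀` and slice energies `∫‖u_j(t)‖² = c² + ∫‖V_j(t)‖²`; classical forward
solutions are global Leray–Hopf solutions from their time-zero slice
(`IsClassicalNSSolutionOn.isLerayHopfOn_of_convex` on the convex time set `Ici 0`), and the limsup-mean
energy is subadditive on nonnegative observables (`longTimeAvgSup_le_add_of_le_add`). The columnar forward
solutions come from PLANAR forward solutions on `T²` (the `2½`-D lift `Torus.twoHalf (v t) 0` along the axis
`2` at every time, `isClassicalNSSolutionOn_twoHalf` on `Ici 0`, then the coordinate swap `0 ↔ 2`).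

WHAT CHANGED w.r.t. v2 and WHY. v2 asked for planar STEADY states (`IsSteadyNSState`), i.e. the steady half
of Constantin–Tarfulea–Vicol's open problem (arXiv:1305.7089, p. 3). The crux only needs bounded LIMSUP-MEAN
energy of Leray–Hopf families, so the honest remaining content is the weaker TIME-DEPENDENT statement:
zero-momentum planar classical forward solutions under one fixed `g ≠ 0` with `ν`-uniformly bounded mean
energy — the archived crux stmt-AnomalousDissipation-10786 (`TwodBoundedEnergyZeroMomentum`) in classical
form, whose numerical face is the `ν`-independent saturation of the undamped 2-D condensate
(Gallet–Young 2013). Steady branches (v2's stub, consumer LANDED as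
`Theorems.boundedEnergyGrid_of_planarSteadyBranch`, p106249) and time-periodic states are special cases.
The per-`j` sup-in-time energy clause is automatic for honest forward solutions at `ν_j > 0` (absorbing
ball) and is carried so that the long-time averages compose without junk (`IsBoundedUnder` of running means).

Registered stubs (def-free signatures; `theorem stub_<name> : … := by sorry`; the composition
`BoundedEnergyGrid_of` concludes the route decl BY NAME with sorries only inside `stub_*`):
* `stub_planarForwardFamily` (XL / open-problem class, HARDEST, held by the lead) — one smooth
  divergence-free mean-zero planar `g ≠ 0`, `ν_j → 0⁺`, classical solutions `v_j` of `NS_{ν_j}(g)` on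
  `[0,∞) × T²` with `∫ v_j(0) = 0`, per-`j` bounded slice energy, and `meanEnergy v_j ≤ E`.
* `stub_columnarForwardOfPlanar` (M; LANDED p108767) — planar forward family ⇒ columnar forward family with
  invariant axis `2` (`twoHalf (v j t) 0`, `isClassicalNSSolutionOn_twoHalf` on `Ici 0` with `R = 0`,
  `φ = q j`; energies slice-wise `integral_norm_sq_twoHalf`, means by `timeMean_eventuallyEq`).
* `stub_forwardAxisZeroOfAxisTwo` (M; LANDED p109084) — axis `2` ⇒ axis `0` by the coordinate swap `0 ↔ 2`
  (the landed `*_conj_swap` kit of `Theorems/ImpulseGridBoundedEnergyGridStubAxisZeroOfAxisTwo`, slice-wise;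
  `timeDerivWithin` commutes with the linear isometry; `integral_norm_sq_conj_swap` is hypothesis-free).
* `stub_gridOfColumnarForward` (M; LANDED p108805) — Galilean column lift `Φ := 1`, `c := 1`,
  `u_j(t) := e₀ + V_j(t)` (the landed `columnLift_*` kit, slice-wise; `derivWithin` of `const + path`;
  `meanEnergy u_j ≤ 1 + E` by `longTimeAvgSup_le_add_of_le_add` with the per-`j` sup bound).
v2's stubs `stub_columnarOfPlanar` / `stub_axisZeroOfAxisTwo` / `stub_gridOfColumnar` are LANDED (p101805,
p103656, p102038) and remain the steady specialisation (door p106249); they are no longer links of the chain.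

Disproof.lean for this crux: none exists (payload `disproof_path` absent on the hub, `ledger crux ls`
2026-08-16T14:05Z).
-/

noncomputable section

-- `Summit.<Summit>.<Problem>`: single-conjunct summit, the duplicate namespace is mandated (CONVENTIONS §2).
set_option linter.dupNamespace false

namespace Summit.AnomalousDissipation.AnomalousDissipation.Cruxes.BoundedEnergyGrid.Sketch

open MeasureTheory Filter Topology Set
open Literature.Analysis.FunctionSpaces Literature.Analysis.FunctionSpaces.Torus
open Literature.Analysis.FluidPDE Literature.Analysis.FluidPDE.Torus

/-- The flat three-torus. -/
local notation "𝕋³" => UnitAddTorus (Fin 3)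
/-- Velocity values on `T³`. -/
local notation "E³" => EuclideanSpace ℝ (Fin 3)
/-- The flat two-torus (transverse plane). -/
local notation "𝕋²" => UnitAddTorus (Fin 2)
/-- Planar velocity values. -/
local notation "E²" => EuclideanSpace ℝ (Fin 2)

/-! ## Registered stubs -/

/-- **Stub A — `stub_planarForwardFamily` (XL / open-problem class; HARDEST; the lead's).**
ONE smooth divergence-free mean-zero planar force `g ≠ 0` on `T²` admits, along some `ν_j → 0⁺`,
classical solutions `(v_j, q_j)` of `NS_{ν_j}(g)` on the forward time set `[0, ∞)`
(`Torus.IsClassicalNSSolutionOn (Ici 0)`) with zero momentum at time `0`, slice energies bounded in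
time for each `j` (any bound `C_j`; automatic for honest solutions at `ν_j > 0`), and limsup-mean energies
`meanEnergy v_j ≤ E` uniformly in `j`. This is the bounded-energy half of the printed open problem of
Constantin–Tarfulea–Vicol (arXiv:1305.7089, p. 3) at zero momentum, time-dependent form (= archived crux
stmt-AnomalousDissipation-10786 with classical in place of Leray–Hopf solutions); steady branches and
time-periodic states are special cases. Why it might fail: every laminar / finite-mode / polynomial-in-ν
class has energy `∝ ν⁻²` (resonant mean force); bounded energy needs the force–velocity correlation to
vanish as `ν → 0` (condensate saturation, Gallet–Young 2013, DNS only). -/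
theorem stub_planarForwardFamily :
    ∃ g : 𝕋² → E², IsSmooth g ∧ IsDivFree g ∧ HasZeroMean g ∧ g ≠ 0 ∧
      ∃ (ν : ℕ → ℝ) (v : ℕ → ℝ → 𝕋² → E²) (q : ℕ → ℝ → 𝕋² → ℝ),
        (∀ j, 0 < ν j) ∧ Tendsto ν atTop (𝓝 0) ∧
        (∀ j, IsClassicalNSSolutionOn (Ici 0) (ν j) (fun _ => g) (v j) (q j)) ∧
        (∀ j, HasZeroMean (v j 0)) ∧
        (∀ j, ∃ C : ℝ, ∀ t, 0 ≤ t → ∫ x, ‖v j t x‖ ^ 2 ≤ C) ∧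
        ∃ E : ℝ, ∀ j, meanEnergy (v j) ≤ E := by
  sorry

/-- **Stub B — `stub_columnarForwardOfPlanar` (M; provable now).** The `2½`-dimensional lift with
zero vertical component, slice-wise in time: a planar forward family `(g, ν_j, v_j, q_j)` gives the columnar
forward family `(twoHalf g 0, ν_j, t ↦ twoHalf (v_j t) 0, t ↦ q_j t ∘ planarProj)` on `T³`, classical on
`Ici 0` (`isClassicalNSSolutionOn_twoHalf` with `S = Ici 0` (`uniqueDiffOn_Ici`), `R = 0`, `φ = q_j`: its force
`twoHalfForce (Ici 0) ν_j (v_j) 0 (q_j) t` is `twoHalf g 0` by the planar momentum equation on `Ici 0`),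
invariant along the axis `2` with vanishing component `2` at every time, zero momentum at time `0`
(`hasZeroMean_twoHalf`), the same per-`j` slice-energy bounds and the same mean energies (slice energies agree
for `t ≥ 0` by `integral_norm_sq_twoHalf`; `timeMean_eventuallyEq`, `limsup_congr`). -/
theorem stub_columnarForwardOfPlanar :
    (∃ g : 𝕋² → E², IsSmooth g ∧ IsDivFree g ∧ HasZeroMean g ∧ g ≠ 0 ∧
      ∃ (ν : ℕ → ℝ) (v : ℕ → ℝ → 𝕋² → E²) (q : ℕ → ℝ → 𝕋² → ℝ),
        (∀ j, 0 < ν j) ∧ Tendsto ν atTop (𝓝 0) ∧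
        (∀ j, IsClassicalNSSolutionOn (Ici 0) (ν j) (fun _ => g) (v j) (q j)) ∧
        (∀ j, HasZeroMean (v j 0)) ∧
        (∀ j, ∃ C : ℝ, ∀ t, 0 ≤ t → ∫ x, ‖v j t x‖ ^ 2 ≤ C) ∧
        ∃ E : ℝ, ∀ j, meanEnergy (v j) ≤ E) →
    ∃ G : 𝕋³ → E³, IsSmooth G ∧ (∀ (s : UnitAddCircle) x, G (x + Pi.single (2 : Fin 3) s) = G x) ∧
      (∀ x, G x 2 = 0) ∧ IsDivFree G ∧ HasZeroMean G ∧ G ≠ 0 ∧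
      ∃ (ν : ℕ → ℝ) (V : ℕ → ℝ → 𝕋³ → E³) (q : ℕ → ℝ → 𝕋³ → ℝ),
        (∀ j, 0 < ν j) ∧ Tendsto ν atTop (𝓝 0) ∧
        (∀ j, IsClassicalNSSolutionOn (Ici 0) (ν j) (fun _ => G) (V j) (q j)) ∧
        (∀ j t (s : UnitAddCircle) x, V j t (x + Pi.single (2 : Fin 3) s) = V j t x) ∧
        (∀ j t x, V j t x 2 = 0) ∧ (∀ j, HasZeroMean (V j 0)) ∧
        (∀ j, ∃ C : ℝ, ∀ t, 0 ≤ t → ∫ x, ‖V j t x‖ ^ 2 ≤ C) ∧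
        ∃ E : ℝ, ∀ j, meanEnergy (V j) ≤ E :=
  -- LANDED: Theorems/ImpulseGridBoundedEnergyGridStubColumnarForwardOfPlanar.lean (p108767, accepted 2026-08-16T14:30Z)
  Summit.AnomalousDissipation.AnomalousDissipation.Theorems.stub_columnarForwardOfPlanar

/-- **Stub C — `stub_forwardAxisZeroOfAxisTwo` (M; provable now).** Equivariance of classical
Navier–Stokes solutions on `T³` (any time set, here `Ici 0`) under the coordinate swap `σ = (0 2)`, a lattice
isometry: with `P x := x ∘ σ` on `T³` and `A := LinearIsometryEquiv.piLpCongrLeft 2 ℝ ℝ σ` on `E³`, the fields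
`G' := A ∘ G ∘ P`, `V'_j(t) := A ∘ V_j(t) ∘ P`, `q'_j(t) := q_j(t) ∘ P` form a columnar forward family with
invariant axis `0` and vanishing component `0`; `div`, `(·∇)·`, `Δ`, `∇` commute with the conjugation (landed
kit `divergence_conj_swap`, `convect_conj_swap`, `laplacian_conj_swap`, `gradient_comp_swap`), the one-sided
time derivative commutes with the linear isometry `A`, joint smoothness is preserved (`stLift` composed with a
linear map in space), zero mean (`hasZeroMean_conj_swap`) and slice energies (`integral_norm_sq_conj_swap`,
hypothesis-free, hence equal mean energies) are preserved, `P (x + s e₀) = P x + s e₂`, `(A w) 0 = w 2`. -/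
theorem stub_forwardAxisZeroOfAxisTwo :
    (∃ G : 𝕋³ → E³, IsSmooth G ∧ (∀ (s : UnitAddCircle) x, G (x + Pi.single (2 : Fin 3) s) = G x) ∧
      (∀ x, G x 2 = 0) ∧ IsDivFree G ∧ HasZeroMean G ∧ G ≠ 0 ∧
      ∃ (ν : ℕ → ℝ) (V : ℕ → ℝ → 𝕋³ → E³) (q : ℕ → ℝ → 𝕋³ → ℝ),
        (∀ j, 0 < ν j) ∧ Tendsto ν atTop (𝓝 0) ∧
        (∀ j, IsClassicalNSSolutionOn (Ici 0) (ν j) (fun _ => G) (V j) (q j)) ∧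
        (∀ j t (s : UnitAddCircle) x, V j t (x + Pi.single (2 : Fin 3) s) = V j t x) ∧
        (∀ j t x, V j t x 2 = 0) ∧ (∀ j, HasZeroMean (V j 0)) ∧
        (∀ j, ∃ C : ℝ, ∀ t, 0 ≤ t → ∫ x, ‖V j t x‖ ^ 2 ≤ C) ∧
        ∃ E : ℝ, ∀ j, meanEnergy (V j) ≤ E) →
    ∃ G : 𝕋³ → E³, IsSmooth G ∧ (∀ (s : UnitAddCircle) x, G (x + Pi.single (0 : Fin 3) s) = G x) ∧
      (∀ x, G x 0 = 0) ∧ IsDivFree G ∧ HasZeroMean G ∧ G ≠ 0 ∧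
      ∃ (ν : ℕ → ℝ) (V : ℕ → ℝ → 𝕋³ → E³) (q : ℕ → ℝ → 𝕋³ → ℝ),
        (∀ j, 0 < ν j) ∧ Tendsto ν atTop (𝓝 0) ∧
        (∀ j, IsClassicalNSSolutionOn (Ici 0) (ν j) (fun _ => G) (V j) (q j)) ∧
        (∀ j t (s : UnitAddCircle) x, V j t (x + Pi.single (0 : Fin 3) s) = V j t x) ∧
        (∀ j t x, V j t x 0 = 0) ∧ (∀ j, HasZeroMean (V j 0)) ∧
        (∀ j, ∃ C : ℝ, ∀ t, 0 ≤ t → ∫ x, ‖V j t x‖ ^ 2 ≤ C) ∧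
        ∃ E : ℝ, ∀ j, meanEnergy (V j) ≤ E :=
  -- LANDED: Theorems/ImpulseGridBoundedEnergyGridStubForwardAxisZeroOfAxisTwo.lean (p109084, accepted 2026-08-16T14:38Z)
  Summit.AnomalousDissipation.AnomalousDissipation.Theorems.stub_forwardAxisZeroOfAxisTwo

/-- **Stub D — `stub_gridOfColumnarForward` (M; provable now).** The Galilean column lift, slice-wise
in time: from a columnar forward family with invariant axis `0` take `Φ := 1` (smooth constant; `∫ 1 = 1` on
the probability torus), the same `G`, `c := 1`, `u_j(t) := e₀ + V_j(t)`, `e₀ := EuclideanSpace.single 0 1`,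
the same pressures. Then `Φ•G = G` (`one_smul`), `∂ₜ u_j = ∂ₜ V_j` within `Ici 0` (`derivWithin` of
`const + path`), `(u_j·∇)u_j = (V_j·∇)V_j` (`columnLift_convect_const_add`,
`columnLift_fderiv_single_zero_eq_zero` from the `x₀`-invariance of the slice), `Δu_j = ΔV_j`,
`div u_j = div V_j` (landed `columnLift_*` kit); joint smoothness (`isSmoothSpaceTimeOn_const`, `.add`);
`∫ u_j(0) = e₀` (`columnLift_integral_single_add`); slice energies `∫‖u_j(t)‖² = 1 + ∫‖V_j(t)‖²` for
`t ≥ 0` (`columnLift_integral_norm_sq_single_add`, `V_j(t) ⊥ e₀` pointwise), whence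
`meanEnergy u_j ≤ 1 + E` (`longTimeAvgSup_le_add_of_le_add` with the constant `1` and the slice energy of
`V_j`, whose running means are bounded by the per-`j` sup bound, `isBoundedUnder_le_timeMean`). -/
theorem stub_gridOfColumnarForward :
    (∃ G : 𝕋³ → E³, IsSmooth G ∧ (∀ (s : UnitAddCircle) x, G (x + Pi.single (0 : Fin 3) s) = G x) ∧
      (∀ x, G x 0 = 0) ∧ IsDivFree G ∧ HasZeroMean G ∧ G ≠ 0 ∧
      ∃ (ν : ℕ → ℝ) (V : ℕ → ℝ → 𝕋³ → E³) (q : ℕ → ℝ → 𝕋³ → ℝ),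
        (∀ j, 0 < ν j) ∧ Tendsto ν atTop (𝓝 0) ∧
        (∀ j, IsClassicalNSSolutionOn (Ici 0) (ν j) (fun _ => G) (V j) (q j)) ∧
        (∀ j t (s : UnitAddCircle) x, V j t (x + Pi.single (0 : Fin 3) s) = V j t x) ∧
        (∀ j t x, V j t x 0 = 0) ∧ (∀ j, HasZeroMean (V j 0)) ∧
        (∀ j, ∃ C : ℝ, ∀ t, 0 ≤ t → ∫ x, ‖V j t x‖ ^ 2 ≤ C) ∧
        ∃ E : ℝ, ∀ j, meanEnergy (V j) ≤ E) →
    ∃ (Φ : 𝕋³ → ℝ) (G : 𝕋³ → E³) (c : ℝ), IsSmooth Φ ∧ IsSmooth G ∧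
      (∀ (s : UnitAddCircle) x, Φ (x + Pi.single (1 : Fin 3) s) = Φ x ∧ Φ (x + Pi.single (2 : Fin 3) s) = Φ x) ∧
      (∫ x, Φ x = 1) ∧ (∀ (s : UnitAddCircle) x, G (x + Pi.single (0 : Fin 3) s) = G x) ∧ (∀ x, G x 0 = 0) ∧
      IsSmooth (fun x => Φ x • G x) ∧ IsDivFree (fun x => Φ x • G x) ∧
      HasZeroMean (fun x => Φ x • G x) ∧ (fun x => Φ x • G x) ≠ 0 ∧ 0 < c ∧
      ∃ (ν : ℕ → ℝ) (u : ℕ → ℝ → 𝕋³ → E³) (q : ℕ → ℝ → 𝕋³ → ℝ),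
        (∀ j, 0 < ν j) ∧ Tendsto ν atTop (𝓝 0) ∧
        (∀ j, IsClassicalNSSolutionOn (Ici 0) (ν j) (fun _ => fun x => Φ x • G x) (u j) (q j)) ∧
        (∀ j, ∫ x, u j 0 x = c • EuclideanSpace.single 0 1) ∧
        ∃ E : ℝ, ∀ j, meanEnergy (u j) ≤ E :=
  -- LANDED: Theorems/ImpulseGridBoundedEnergyGridStubGridOfColumnarForward.lean (p108805, accepted 2026-08-16T14:31Z)
  Summit.AnomalousDissipation.AnomalousDissipation.Theorems.stub_gridOfColumnarForward

/-! ## The crux from the line -/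

/-- **The crux from the line** — the ONLY theorem of this file concluding
`Summit.AnomalousDissipation.AnomalousDissipation.Theses.ImpulseGrid.BoundedEnergyGrid`, BY NAME, with no
hypotheses; the registered stubs are invoked (sorries live only in `stub_*`). Chain:
planar forward family (stub A) ⟹ columnar forward family, axis 2 (stub B) ⟹ axis 0 (stub C) ⟹ grid
forward family (stub D) ⟹ crux, the last arrow proved inline: a grid forward family carries the design
clauses verbatim, a classical solution on the convex forward time set `Ici 0 ⊇ Icc 0 T` is Leray–Hopf on
`[0, T)` from the datum `u_j 0` for every `T > 0` (`IsClassicalNSSolutionOn.isLerayHopfOn_of_convex`), i.e. a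
global Leray–Hopf solution, and the mean-energy bound is carried as is. -/
theorem BoundedEnergyGrid_of :
    Summit.AnomalousDissipation.AnomalousDissipation.Theses.ImpulseGrid.BoundedEnergyGrid := by
  obtain ⟨Φ, G, c, hΦ, hG, hΦinv, hΦmass, hGinv, hG0, hfs, hfd, hfm, hfne, hc, ν, u, q, hν, hν0, hcl,
    hmom, E, hE⟩ :=
    stub_gridOfColumnarForward (stub_forwardAxisZeroOfAxisTwo (stub_columnarForwardOfPlanar
      stub_planarForwardFamily))
  exact ⟨Φ, G, c, hΦ, hG, hΦinv, hΦmass, hGinv, hG0, hfs, hfd, hfm, hfne, hc, ν, fun j => u j 0, u, hν,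
    hν0, fun j T hT => (hcl j).isLerayHopfOn_of_convex (convex_Ici 0) hT Icc_subset_Ici_self, hmom, E, hE⟩

end Summit.AnomalousDissipation.AnomalousDissipation.Cruxes.BoundedEnergyGrid.Sketch

end
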